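import Literature.NumberTheory.DiophantineGeometry.CatalanStickelbergerBridge
import HarnessLib

/-!
# `q`-th roots modulo powers of `𝔭 = (ζ_p - 1)` in `ℤ[ζ_p]` (finite-level `π`-adic analysis)

[Schoof2009, Chapter 8] computes with `q`-th roots in the `π`-adic completion `ℤ_p[ζ_p]`
("the Taylor series for the `q`-th root of `1 + μ` converges", Exercise 8.2, and the uniqueness
claim in the proof of Proposition 8.2: "there are no primitive `q`-th roots of unity in
`ℚ_p(ζ_p)`"). For the finite-level version of that argument used in the tree we record the
elementary facts about `q`-th powers in the finite rings `𝓞 K ⧸ 𝔭^M`, `𝔭 = (ζ_p - 1)`, for a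
prime `q` with `q ≠ p` and `q ∤ p - 1`:

* `Catalan.pow_eq_one_mod_of_pow_prime` — if `π^M ∣ w^q - 1` then `π^M ∣ w - 1` (no non-trivial
  `q`-th roots of unity modulo `𝔭^M`);
* `Catalan.dvd_sub_of_dvd_pow_sub_pow` — `π^M ∣ w₁^q - w₂^q`, `π ∤ w₂` ⟹ `π^M ∣ w₁ - w₂`
  (uniqueness of `q`-th roots of units);
* `Catalan.exists_pow_sub_dvd` — every `a` with `π ∤ a` is a `q`-th power modulo `𝔭^M`
  (existence, by finiteness of `(𝓞 K ⧸ 𝔭^M)ˣ`).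

Everything is proved; no definitions, no named facts.

## References

* R. Schoof, *Catalan's Conjecture*, Universitext, Springer 2009 [Schoof2009], Chapter 8
  (Proposition 8.2, its Claim, Exercise 8.2) — held, `lit read book:schoof2009-catalan-s-conjecture`
  (PDF pp. 128–129).
-/

namespace Literature.NumberTheory.DiophantineGeometry

namespace Catalan

open Finset NumberField

variable {p : ℕ} [hp : Fact p.Prime] {K : Type*} [Field K] [NumberField K]
  [IsCyclotomicExtension {p} ℚ K] {ζ : K}

/-- Fermat in `ℤ[ζ_p]/(ζ_p - 1) ≅ 𝔽_p`: if `π = ζ - 1` does not divide `w`, then `π ∣ w^(p-1) - 1`.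
[folklore] -/
theorem zeta_sub_one_dvd_pow_sub_one (hζ : IsPrimitiveRoot ζ p) (hp2 : p ≠ 2) {w : 𝓞 K}
    (hw : ¬ hζ.toInteger - 1 ∣ w) : hζ.toInteger - 1 ∣ w ^ (p - 1) - 1 := by
  classical
  set π : 𝓞 K := hζ.toInteger - 1 with hπdef
  set P : Ideal (𝓞 K) := Ideal.span {π} with hPdef
  have hπ : Prime π := hζ.zeta_sub_one_prime'
  haveI hPp : P.IsPrime := (Ideal.span_singleton_prime hπ.ne_zero).mpr hπ
  have hP0 : P ≠ ⊥ := by rw [hPdef, Ne, Ideal.span_singleton_eq_bot]; exact hπ.ne_zero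
  haveI : P.IsMaximal := hPp.isMaximal hP0
  letI : Field (𝓞 K ⧸ P) := Ideal.Quotient.field P
  haveI : Finite (𝓞 K ⧸ P) := Ideal.finiteQuotientOfFreeOfNeBot P hP0
  letI : Fintype (𝓞 K ⧸ P) := Fintype.ofFinite _
  have hcard : Fintype.card (𝓞 K ⧸ P) = p := by
    rw [← Nat.card_eq_fintype_card, ← Submodule.cardQuot_apply, ← Ideal.absNorm_apply, hPdef,
      Ideal.absNorm_span_singleton, hπdef, hζ.norm_toInteger_sub_one_of_prime_ne_two' hp2,
      Int.natAbs_natCast]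
  have hw0 : Ideal.Quotient.mk P w ≠ 0 := by
    rwa [Ne, Ideal.Quotient.eq_zero_iff_mem, hPdef, Ideal.mem_span_singleton]
  have h1 := FiniteField.pow_card_sub_one_eq_one (Ideal.Quotient.mk P w) hw0
  rw [hcard, ← map_pow, ← map_one (Ideal.Quotient.mk P), Ideal.Quotient.eq, hPdef,
    Ideal.mem_span_singleton] at h1
  exact h1

/-- **No non-trivial `q`-th roots of unity modulo `𝔭^M`** (`q` prime, `q ≠ p`, `q ∤ p - 1`): if
`π^M ∣ w^q - 1` then `π^M ∣ w - 1`. (Modulo `𝔭` the order of `w` divides `gcd(q, p-1) = 1`; then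
`w = 1 + π s` and `(1 + πs)^q - 1 = π s (q + π s(…))` with the cofactor prime to `π`.)
[cite: Schoof2009, Proposition 8.2 (Claim)] -/
theorem pow_eq_one_mod_of_pow_prime (hζ : IsPrimitiveRoot ζ p) (hp2 : p ≠ 2) {q : ℕ} (hq : q.Prime)
    (hpq : p ≠ q) (hqp1 : ¬ q ∣ p - 1) {M : ℕ} {w : 𝓞 K}
    (h : (hζ.toInteger - 1) ^ M ∣ w ^ q - 1) : (hζ.toInteger - 1) ^ M ∣ w - 1 := by
  classical
  rcases Nat.eq_zero_or_pos M with rfl | hM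
  · simp
  set π : 𝓞 K := hζ.toInteger - 1 with hπdef
  have hπ : Prime π := hζ.zeta_sub_one_prime'
  have hp1 : 1 ≤ p - 1 := by have := hp.out.two_le; omega
  -- `π ∣ p` and `π ∤ q`
  have hπp : π ∣ (p : 𝓞 K) := by
    obtain ⟨u, hu⟩ := IsCyclotomicExtension.Rat.associated_zeta_sub_one_pow_prime p hζ
    rw [← hπdef] at hu
    rw [← hu]
    exact dvd_mul_of_dvd_left (dvd_pow_self π (by omega)) _
  have hπq : ¬ π ∣ (q : 𝓞 K) := by
    intro hdvd
    obtain ⟨a, b, hab⟩ : IsCoprime (p : ℤ) (q : ℤ) :=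
      Nat.isCoprime_iff_coprime.mpr ((Nat.coprime_primes hp.out hq).mpr hpq)
    have h1 : π ∣ (1 : 𝓞 K) := by
      have : (1 : 𝓞 K) = (a : 𝓞 K) * p + (b : 𝓞 K) * q := by exact_mod_cast congrArg (Int.cast (R := 𝓞 K)) hab.symm
      rw [this]
      exact dvd_add (dvd_mul_of_dvd_right hπp _) (dvd_mul_of_dvd_right hdvd _)
    exact hπ.not_unit (isUnit_of_dvd_one h1)
  -- Step 1: `π ∣ w - 1`
  have hπw : ¬ π ∣ w := by
    intro hw
    have h1 : π ∣ w ^ q := dvd_pow hw hq.ne_zero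
    have h2 : π ∣ w ^ q - 1 := (dvd_pow_self π hM.ne').trans h
    have : π ∣ w ^ q - (w ^ q - 1) := dvd_sub h1 h2
    rw [sub_sub_cancel] at this
    exact hπ.not_unit (isUnit_of_dvd_one this)
  have hw1 : π ∣ w - 1 := by
    -- the order of `w` modulo `π` divides `gcd(q, p - 1) = 1`
    have h1 : π ∣ w ^ q - 1 := (dvd_pow_self π hM.ne').trans h
    have h2 : π ∣ w ^ (p - 1) - 1 := zeta_sub_one_dvd_pow_sub_one hζ hp2 hπw
    have hcop : q.Coprime (p - 1) := (Nat.Prime.coprime_iff_not_dvd hq).mpr hqp1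
    obtain ⟨s, t, hst⟩ : ∃ s t : ℕ, s * q = t * (p - 1) + 1 := by
      obtain ⟨s, -, hs⟩ := Nat.exists_mul_mod_eq_one_of_coprime hcop (by omega : 1 < p - 1)
      refine ⟨s, q * s / (p - 1), ?_⟩
      have := Nat.div_add_mod (q * s) (p - 1)
      rw [mul_comm s q]
      rw [hs] at this
      linarith [Nat.div_mul_cancel (show (p - 1) ∣ (p - 1) * (q * s / (p - 1)) from dvd_mul_right _ _),
        mul_comm (p - 1) (q * s / (p - 1))]
    have h3 : π ∣ w ^ (s * q) - 1 := by
      rw [mul_comm, pow_mul]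
      exact h1.trans (by simpa using sub_dvd_pow_sub_pow (w ^ q) 1 s)
    have h4 : π ∣ w ^ (t * (p - 1)) - 1 := by
      rw [mul_comm, pow_mul]
      exact h2.trans (by simpa using sub_dvd_pow_sub_pow (w ^ (p - 1)) 1 t)
    have h5 : w ^ (s * q) - 1 - w * (w ^ (t * (p - 1)) - 1) = w - 1 := by rw [hst]; ring
    rw [← h5]
    exact dvd_sub h3 (dvd_mul_of_dvd_right h4 _)
  -- Step 2: `w = 1 + π s` and the cofactor argument
  obtain ⟨s, hs⟩ := hw1
  have hws : w = 1 + π * s := by linear_combination hs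
  have hexp : w ^ q - 1 = (π * s) * ∑ j ∈ range q, (1 + π * s) ^ j := by
    have hg := geom_sum_mul (1 + π * s) q
    rw [add_sub_cancel_left] at hg
    rw [hws, ← hg, mul_comm]
  have hcof : ¬ π ∣ ∑ j ∈ range q, (1 + π * s) ^ j := by
    intro hdvd
    have h1 : π ∣ ∑ j ∈ range q, ((1 + π * s) ^ j - 1) := by
      refine Finset.dvd_sum fun j _ => (dvd_mul_right π s).trans ?_
      simpa using sub_dvd_pow_sub_pow (1 + π * s) 1 j
    have h2 : ∑ j ∈ range q, ((1 + π * s) ^ j - 1) = (∑ j ∈ range q, (1 + π * s) ^ j) - q := by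
      rw [sum_sub_distrib, sum_const, card_range]
      simp
    rw [h2] at h1
    have h3 := dvd_sub hdvd h1
    rw [sub_sub_cancel] at h3
    exact hπq h3
  have h1 : π ^ M ∣ (π * s) * ∑ j ∈ range q, (1 + π * s) ^ j := by rw [← hexp]; exact h
  have h2 : π ^ M ∣ π * s := hπ.pow_dvd_of_dvd_mul_right M hcof h1
  rwa [← hs] at h2

/-- **Uniqueness of `q`-th roots of units modulo `𝔭^M`**: if `π^M ∣ w₁^q - w₂^q` and
`π ∤ w₂`, then `π^M ∣ w₁ - w₂`. [cite: Schoof2009, Proposition 8.2 (Claim)] -/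
theorem dvd_sub_of_dvd_pow_sub_pow (hζ : IsPrimitiveRoot ζ p) (hp2 : p ≠ 2) {q : ℕ} (hq : q.Prime)
    (hpq : p ≠ q) (hqp1 : ¬ q ∣ p - 1) {M : ℕ} {w₁ w₂ : 𝓞 K} (hw₂ : ¬ hζ.toInteger - 1 ∣ w₂)
    (h : (hζ.toInteger - 1) ^ M ∣ w₁ ^ q - w₂ ^ q) : (hζ.toInteger - 1) ^ M ∣ w₁ - w₂ := by
  classical
  set π : 𝓞 K := hζ.toInteger - 1 with hπdef
  have hπ : Prime π := hζ.zeta_sub_one_prime'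
  -- `w₂` is invertible modulo `π^M`: `b w₂ ≡ 1`
  have hmax : (Ideal.span {π}).IsMaximal := by
    haveI := (Ideal.span_singleton_prime hπ.ne_zero).mpr hπ
    exact Ideal.IsPrime.isMaximal this (by rw [Ne, Ideal.span_singleton_eq_bot]; exact hπ.ne_zero)
  have hcop : IsCoprime π w₂ := by
    rw [← Ideal.isCoprime_span_singleton_iff, Ideal.isCoprime_iff_sup_eq]
    by_contra hne
    have hle := hmax.eq_of_le hne le_sup_left
    have : w₂ ∈ Ideal.span {π} := by
      rw [hle]; exact Ideal.mem_sup_right (Ideal.mem_span_singleton_self _)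
    exact hw₂ (Ideal.mem_span_singleton.mp this)
  obtain ⟨a, b, hab⟩ := hcop.pow_left (m := M)
  -- `w = w₁ b` has `w^q ≡ 1`
  have h1 : π ^ M ∣ (w₁ * b) ^ q - 1 := by
    have h2 : (w₁ * b) ^ q - 1 = (w₁ ^ q - w₂ ^ q) * b ^ q + ((w₂ * b) ^ q - 1) := by ring
    have h3 : π ^ M ∣ (w₂ * b) ^ q - 1 := by
      have h4 : π ^ M ∣ w₂ * b - 1 := ⟨-a, by linear_combination hab⟩
      exact h4.trans (by simpa using sub_dvd_pow_sub_pow (w₂ * b) 1 q)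
    rw [h2]
    exact dvd_add (h.mul_right _) h3
  have h5 := pow_eq_one_mod_of_pow_prime hζ hp2 hq hpq hqp1 h1
  have h6 : w₁ - w₂ = (w₁ * b - 1) * w₂ - w₁ * (b * w₂ - 1) := by ring
  have h7 : π ^ M ∣ b * w₂ - 1 := ⟨-a, by linear_combination hab⟩
  rw [h6]
  exact dvd_sub (h5.mul_right _) (h7.mul_left _)

/-- **Existence of `q`-th roots of units modulo `𝔭^M`**: if `π ∤ a` then `a ≡ w^q (mod π^M)`
for some `w` (the `q`-th power map on the finite group `(𝓞 K ⧸ 𝔭^M)ˣ` is injective, hence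
onto). [cite: Schoof2009, Exercise 8.2 and Proposition 8.2 (Claim)] -/
theorem exists_pow_sub_dvd (hζ : IsPrimitiveRoot ζ p) (hp2 : p ≠ 2) {q : ℕ} (hq : q.Prime)
    (hpq : p ≠ q) (hqp1 : ¬ q ∣ p - 1) (M : ℕ) {a : 𝓞 K} (ha : ¬ hζ.toInteger - 1 ∣ a) :
    ∃ w : 𝓞 K, (hζ.toInteger - 1) ^ M ∣ w ^ q - a := by
  classical
  rcases Nat.eq_zero_or_pos M with rfl | hM
  · exact ⟨0, by simp⟩
  set π : 𝓞 K := hζ.toInteger - 1 with hπdef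
  have hπ : Prime π := hζ.zeta_sub_one_prime'
  set I : Ideal (𝓞 K) := Ideal.span {π ^ M} with hIdef
  have hI0 : I ≠ ⊥ := by
    rw [hIdef, Ne, Ideal.span_singleton_eq_bot]; exact pow_ne_zero _ hπ.ne_zero
  haveI : Finite (𝓞 K ⧸ I) := Ideal.finiteQuotientOfFreeOfNeBot I hI0
  set R := 𝓞 K ⧸ I
  -- the `q`-th power map on `Rˣ` is injective
  have hinj : Function.Injective fun u : Rˣ => u ^ q := by
    intro u₁ u₂ h12
    simp only at h12
    obtain ⟨w₁, hw₁⟩ := Ideal.Quotient.mk_surjective (u₁ : R)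
    obtain ⟨w₂, hw₂⟩ := Ideal.Quotient.mk_surjective (u₂ : R)
    have hw₂π : ¬ π ∣ w₂ := by
      intro hdvd
      have hu : IsUnit (Ideal.Quotient.mk I w₂) := by rw [hw₂]; exact u₂.isUnit
      have hmem : w₂ ∈ Ideal.span {π} := Ideal.mem_span_singleton.mpr hdvd
      have hIle : I ≤ Ideal.span {π} := by
        rw [hIdef, Ideal.span_singleton_le_span_singleton]
        exact dvd_pow_self π hM.ne'
      -- a unit of `R` cannot lie in the maximal ideal `(π)/I`
      obtain ⟨v, hv⟩ := hu.exists_right_inv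
      obtain ⟨wv, hwv⟩ := Ideal.Quotient.mk_surjective v
      rw [← hwv, ← map_mul, ← map_one (Ideal.Quotient.mk I), Ideal.Quotient.eq] at hv
      have h2 : w₂ * wv - 1 ∈ Ideal.span {π} := hIle hv
      have h3 : (1 : 𝓞 K) ∈ Ideal.span {π} := by
        have := (Ideal.span {π}).sub_mem (Ideal.mul_mem_right wv _ hmem) h2
        rwa [sub_sub_cancel] at this
      exact hπ.not_unit (isUnit_of_dvd_one (Ideal.mem_span_singleton.mp h3))
    have h3 : π ^ M ∣ w₁ ^ q - w₂ ^ q := by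
      have := congrArg (fun u : Rˣ => (u : R)) h12
      simp only [Units.val_pow_eq_pow_val, ← hw₁, ← hw₂, ← map_pow] at this
      rw [← Ideal.mem_span_singleton, ← hIdef, ← Ideal.Quotient.eq]
      exact this
    have h4 := dvd_sub_of_dvd_pow_sub_pow hζ hp2 hq hpq hqp1 hw₂π h3
    apply Units.ext
    rw [← hw₁, ← hw₂, Ideal.Quotient.eq, hIdef, Ideal.mem_span_singleton]
    exact h4
  have hsurj : Function.Surjective fun u : Rˣ => u ^ q := Finite.surjective_of_injective hinj
  -- `a` is a unit of `R`
  have hmax : (Ideal.span {π}).IsMaximal := by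
    haveI := (Ideal.span_singleton_prime hπ.ne_zero).mpr hπ
    exact Ideal.IsPrime.isMaximal this (by rw [Ne, Ideal.span_singleton_eq_bot]; exact hπ.ne_zero)
  have hcop : IsCoprime π a := by
    rw [← Ideal.isCoprime_span_singleton_iff, Ideal.isCoprime_iff_sup_eq]
    by_contra hne
    have hle := hmax.eq_of_le hne le_sup_left
    have : a ∈ Ideal.span {π} := by
      rw [hle]; exact Ideal.mem_sup_right (Ideal.mem_span_singleton_self _)
    exact ha (Ideal.mem_span_singleton.mp this)
  obtain ⟨c, b, hcb⟩ := hcop.pow_left (m := M)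
  have haunit : IsUnit (Ideal.Quotient.mk I a) := by
    refine IsUnit.of_mul_eq_one (Ideal.Quotient.mk I b) ?_
    rw [← map_mul, ← map_one (Ideal.Quotient.mk I), Ideal.Quotient.eq, hIdef,
      Ideal.mem_span_singleton]
    exact ⟨-c, by linear_combination hcb⟩
  obtain ⟨u, hu⟩ := hsurj haunit.unit
  obtain ⟨w, hw⟩ := Ideal.Quotient.mk_surjective (u : R)
  refine ⟨w, ?_⟩
  have h1 : (Ideal.Quotient.mk I) (w ^ q) = Ideal.Quotient.mk I a := by
    have := congrArg (fun u : Rˣ => (u : R)) hu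
    simp only [Units.val_pow_eq_pow_val, IsUnit.unit_spec] at this
    rw [map_pow, hw]
    exact this
  rw [Ideal.Quotient.eq, hIdef, Ideal.mem_span_singleton] at h1
  exact h1

end Catalan





end Literature.NumberTheory.DiophantineGeometry
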